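import Summits.QuantumFields.QCD.Theorems.SmallFieldUltracontractivity.Negative.Tightness
import Literature.Probability.LatticeModels.TorusFourierProofs
import Summits.QuantumFields.QCD.Theorems.HeatSlicedQuarksSmallFieldUltracontractivityStubFreeKernelDecayAux3

/-!
# Stub `stub_freeKernelDecay` of line `point-centred-axial-parabolic`
(crux `Summit.QuantumFields.QCD.Theses.HeatSlicedQuarks.SmallFieldUltracontractivity`, item stmt-QuantumFields-8871)

`FreeKernelFourier → FreeKernelDecay`: from the torus Fourier representation of the free massive Wilson
heat kernel `e^{−σ D₁ᴴ D₁}((x,a,α),(z,b,β)) = δ_{(a,α),(b,β)} L⁻⁴ Σ_k e^{−σ h_m(k)} χ_k(x − z)` we derive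
the parabolic polynomial decay `|k_σ(x,z)| ≤ C e^{−σm²} (1+σ)/(1+σ+d²)³` of the entries and the
half-derivative gain `≤ C e^{−σm²} √(1+σ)/(1+σ+d²)³` for nearest-neighbour column differences,
`d = torusDist x z`, uniformly in `L`, `m ∈ [−1/2, 1]`, `0 ≤ σ ≤ L²`.

The analysis is in the helper files `…StubFreeKernelDecayAux1–3` (registered sub-goals
`stub_fkdSymbolWindow`, `stub_fkdTorusToolkit`, `stub_fkdSymbolPointwise`).  Here summation by parts and
the multiplier bound `‖1 − conj χ_y(e_μ)‖ ≥ 4|y_μ|_per/L` turn the pointwise bound into the decay engine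
`fourierSum_decay n`: `|y_μ|_perⁿ ‖K_σ(y)‖ ≤ Cₙ (1+σ)^{n/2−2} e^{−σm²}` (with the extra `(1+σ)^{−1/2}` for
differences); the stub then chooses the direction `μ` attaining `torusDist x z = max_μ |(x − z)_μ|_per`,
uses `n = 0` and `n = 6`, and interpolates `min((1+σ)⁻², (1+σ) d⁻⁶) ≤ 8 (1+σ)/(1+σ+d²)³`
(`interp_entry`, `interp_diff`).

References: folklore (free lattice heat kernel estimates); pure theorem file (no definitions).
-/

noncomputable section

namespace Summit.QuantumFields.QCD.Cruxes.SmallFieldUltracontractivity.PointCentredAxialParabolic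

open Literature.MathematicalPhysics.QuantumLattice Literature.MathematicalPhysics.QuantumFieldTheory
open Literature.Probability.LatticeModels (TorusSite torusChar torusChar_sub_right norm_torusChar)
open Summit.QuantumFields.QCD.Theorems.SmallFieldUltracontractivity.Negative
open scoped Matrix ComplexConjugate

/-! ### From the pointwise bound to the decay engine -/

section Engine

variable {L : ℕ}

/-- **From a pointwise bound to decay.** If `‖Δ_μⁿ F̃(k)‖ ≤ A (1+σ)^{n/2} L⁻ⁿ g(k)` with
`Σ_k g(k) ≤ R (12L/√(1+σ))⁴`, then `|y_μ|_perⁿ ‖L⁻⁴ Σ_k F̃(k) χ_k(y)‖ ≤ A R 12⁴ (1+σ)^{n/2} / (1+σ)²`. -/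
theorem decay_from_pointwise [NeZero L] (y : TorusSite 4 L) (μ : Fin 4) (n : ℕ) (Ft : TorusSite 4 L → ℂ)
    {σ A R : ℝ} (hσ : 0 ≤ σ) (hA : 0 ≤ A) (hR : 0 ≤ R) (g : TorusSite 4 L → ℝ)
    (hΔ : ∀ k, ‖((fun (G : TorusSite 4 L → ℂ) (k : TorusSite 4 L) => G k - G (k + Pi.single μ 1))^[n] Ft) k‖ ≤ A * (Real.sqrt (1 + σ) ^ n / (L : ℝ) ^ n) * g k)
    (hg : ∑ k, g k ≤ R * (12 * L / Real.sqrt (1 + σ)) ^ 4) :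
    ((min (ZMod.val (y μ)) (L - ZMod.val (y μ)) : ℕ) : ℝ) ^ n * ‖∑ k : TorusSite 4 L, ((L : ℂ) ^ 2)⁻¹ * ((L : ℂ) ^ 2)⁻¹ * (Ft k * torusChar k y)‖ ≤
      A * R * 12 ^ 4 * Real.sqrt (1 + σ) ^ n * ((1 + σ) ^ 2)⁻¹ := by
  have hL : (0 : ℝ) < L := by exact_mod_cast Nat.pos_of_ne_zero (NeZero.ne L)
  have hs : 0 < Real.sqrt (1 + σ) := Real.sqrt_pos.2 (by linarith)
  have h1 := norm_pow_mul_norm_sum_le μ y n Ft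
  have h2 : ∑ k, ‖((fun (G : TorusSite 4 L → ℂ) (k : TorusSite 4 L) => G k - G (k + Pi.single μ 1))^[n] Ft) k‖ ≤ A * (Real.sqrt (1 + σ) ^ n / (L : ℝ) ^ n) * (R * (12 * L / Real.sqrt (1 + σ)) ^ 4) := by
    refine (Finset.sum_le_sum fun k _ => hΔ k).trans ?_
    rw [← Finset.mul_sum]
    exact mul_le_mul_of_nonneg_left hg (by positivity)
  have h3 := four_mul_cyclicAbs_div_le_norm y μ
  have hP0 : 0 ≤ ((min (ZMod.val (y μ)) (L - ZMod.val (y μ)) : ℕ) : ℝ) := Nat.cast_nonneg _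
  have hP : ((min (ZMod.val (y μ)) (L - ZMod.val (y μ)) : ℕ) : ℝ) ≤ (L : ℝ) / 4 * ‖1 - conj (torusChar y (Pi.single μ 1))‖ := by
    rw [div_le_iff₀ hL] at h3
    linarith
  have hPn := pow_le_pow_left₀ hP0 hP n
  rw [← Finset.mul_sum, norm_mul, norm_mul, norm_inv, norm_pow, Complex.norm_natCast]
  have hX : 0 ≤ ‖∑ k, Ft k * torusChar k y‖ := norm_nonneg _
  calc ((min (ZMod.val (y μ)) (L - ZMod.val (y μ)) : ℕ) : ℝ) ^ n * (((L : ℝ) ^ 2)⁻¹ * ((L : ℝ) ^ 2)⁻¹ * ‖∑ k, Ft k * torusChar k y‖)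
      ≤ ((L : ℝ) / 4 * ‖1 - conj (torusChar y (Pi.single μ 1))‖) ^ n *
          (((L : ℝ) ^ 2)⁻¹ * ((L : ℝ) ^ 2)⁻¹ * ‖∑ k, Ft k * torusChar k y‖) := by gcongr
    _ = ((L : ℝ) / 4) ^ n * ((L : ℝ) ^ 2)⁻¹ * ((L : ℝ) ^ 2)⁻¹ *
          (‖1 - conj (torusChar y (Pi.single μ 1))‖ ^ n * ‖∑ k, Ft k * torusChar k y‖) := by
        ring
    _ ≤ ((L : ℝ) / 4) ^ n * ((L : ℝ) ^ 2)⁻¹ * ((L : ℝ) ^ 2)⁻¹ *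
          (A * (Real.sqrt (1 + σ) ^ n / (L : ℝ) ^ n) * (R * (12 * L / Real.sqrt (1 + σ)) ^ 4)) :=
        mul_le_mul_of_nonneg_left (h1.trans h2) (by positivity)
    _ = A * R * 12 ^ 4 * (1 / 4) ^ n * Real.sqrt (1 + σ) ^ n * (Real.sqrt (1 + σ) ^ 4)⁻¹ := by
        field_simp [hL.ne', hs.ne']
        ring
    _ ≤ A * R * 12 ^ 4 * 1 * Real.sqrt (1 + σ) ^ n * (Real.sqrt (1 + σ) ^ 4)⁻¹ := by
        gcongr; exact pow_le_one₀ (by norm_num) (by norm_num)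
    _ = A * R * 12 ^ 4 * Real.sqrt (1 + σ) ^ n * ((1 + σ) ^ 2)⁻¹ := by
        rw [mul_one, show Real.sqrt (1 + σ) ^ 4 = (Real.sqrt (1 + σ) ^ 2) ^ 2 by ring,
          Real.sq_sqrt (by linarith)]

end Engine

/-! ### The decay engine -/

/-- **Decay engine for the free massive Wilson heat kernel.** For every `n` there is `C ≥ 0` such that
for all `L ≥ 1`, `m ∈ [−1/2, 1]`, `0 ≤ σ ≤ L²`, `y ∈ (ℤ/L)⁴` and every direction `μ`, with
`K_σ(y) = L⁻⁴ Σ_k e^{−σ h_m(k)} χ_k(y)` and `|y_μ|_per = min(y_μ.val, L − y_μ.val)`: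
`|y_μ|_perⁿ ‖K_σ(y)‖ ≤ C (1+σ)^{n/2} (1+σ)⁻² e^{−σm²}` and, for every `ν`,
`|y_μ|_perⁿ ‖K_σ(y) − K_σ(y − e_ν)‖ ≤ C (1+σ)^{n/2} (1+σ)^{−1/2} (1+σ)⁻² e^{−σm²}`. -/
theorem fourierSum_decay (n : ℕ) : ∃ C : ℝ, 0 ≤ C ∧
    ∀ (L : ℕ) [NeZero L] (m : ℝ), m ∈ Set.Icc (-(1 / 2 : ℝ)) 1 → ∀ σ : ℝ, 0 ≤ σ → σ ≤ (L : ℝ) ^ 2 →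
    ∀ (y : TorusSite 4 L) (μ : Fin 4),
      ((min (ZMod.val (y μ)) (L - ZMod.val (y μ)) : ℕ) : ℝ) ^ n * ‖(∑ k : TorusSite 4 L, ((L : ℂ) ^ 2)⁻¹ * ((L : ℂ) ^ 2)⁻¹ * (Complex.exp (-(σ : ℂ) * ((((m + ∑ ν : Fin 4, (1 - Real.cos (2 * Real.pi * (ZMod.val (k ν) : ℝ) / L))) ^ 2 + ∑ ν : Fin 4, Real.sin (2 * Real.pi * (ZMod.val (k ν) : ℝ) / L) ^ 2) : ℝ) : ℂ)) * torusChar k y))‖ ≤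
          C * Real.sqrt (1 + σ) ^ n * ((1 + σ) ^ 2)⁻¹ * Real.exp (-(σ * m ^ 2)) ∧
      ∀ ν : Fin 4,
        ((min (ZMod.val (y μ)) (L - ZMod.val (y μ)) : ℕ) : ℝ) ^ n * ‖(∑ k : TorusSite 4 L, ((L : ℂ) ^ 2)⁻¹ * ((L : ℂ) ^ 2)⁻¹ * (Complex.exp (-(σ : ℂ) * ((((m + ∑ ν : Fin 4, (1 - Real.cos (2 * Real.pi * (ZMod.val (k ν) : ℝ) / L))) ^ 2 + ∑ ν : Fin 4, Real.sin (2 * Real.pi * (ZMod.val (k ν) : ℝ) / L) ^ 2) : ℝ) : ℂ)) * torusChar k y)) - (∑ k : TorusSite 4 L, ((L : ℂ) ^ 2)⁻¹ * ((L : ℂ) ^ 2)⁻¹ * (Complex.exp (-(σ : ℂ) * ((((m + ∑ ν : Fin 4, (1 - Real.cos (2 * Real.pi * (ZMod.val (k ν) : ℝ) / L))) ^ 2 + ∑ ν : Fin 4, Real.sin (2 * Real.pi * (ZMod.val (k ν) : ℝ) / L) ^ 2) : ℝ) : ℂ)) * torusChar k (y - Pi.single ν 1)))‖ ≤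
          C * Real.sqrt (1 + σ) ^ n * (Real.sqrt (1 + σ))⁻¹ * ((1 + σ) ^ 2)⁻¹ * Real.exp (-(σ * m ^ 2)) := by
  refine ⟨6 * ((n.factorial : ℝ) * Real.exp 2 * (10 * Real.pi) ^ n * Real.exp (10 * Real.pi ^ 2 * (n : ℝ) ^ 2)) * 12 ^ 4, by positivity, ?_⟩
  intro L _ m hm σ hσ hσL y μ
  have hL : (0 : ℝ) < L := by exact_mod_cast Nat.pos_of_ne_zero (NeZero.ne L)
  have hs : 0 < Real.sqrt (1 + σ) := Real.sqrt_pos.2 (by linarith)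
  have hK : 0 ≤ ((n.factorial : ℝ) * Real.exp 2 * (10 * Real.pi) ^ n * Real.exp (10 * Real.pi ^ 2 * (n : ℝ) ^ 2)) := by positivity
  have hP := norm_iterate_torusDiff_symbol_le n m hm σ hσ hσL μ
  refine ⟨?_, fun ν => ?_⟩
  · -- entries: `p = 1`, `a = 0`
    have hΔ := hP 0 (fun _ => 1) (fun _ => rfl)
    have hsum : (∑ k : TorusSite 4 L, ((L : ℂ) ^ 2)⁻¹ * ((L : ℂ) ^ 2)⁻¹ * (Complex.exp (-(σ : ℂ) * ((((m + ∑ ν : Fin 4, (1 - Real.cos (2 * Real.pi * (ZMod.val (k ν) : ℝ) / L))) ^ 2 + ∑ ν : Fin 4, Real.sin (2 * Real.pi * (ZMod.val (k ν) : ℝ) / L) ^ 2) : ℝ) : ℂ)) * torusChar k y)) =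
        ∑ k : TorusSite 4 L, ((L : ℂ) ^ 2)⁻¹ * ((L : ℂ) ^ 2)⁻¹ *
          (((fun _ : TorusSite 4 L => (1 : ℂ)) k * (1 - 0 * Complex.exp (-(Complex.I * ((2 * Real.pi * (ZMod.val (k μ) : ℝ) / L : ℝ) : ℂ)))) * Complex.exp (-(σ : ℂ) * ((((m + ∑ ν : Fin 4, (1 - Real.cos (2 * Real.pi * (ZMod.val (k ν) : ℝ) / L))) ^ 2 + ∑ ν : Fin 4, Real.sin (2 * Real.pi * (ZMod.val (k ν) : ℝ) / L) ^ 2) : ℝ) : ℂ))) * torusChar k y) := by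
      refine Finset.sum_congr rfl fun k _ => ?_
      simp
    rw [hsum]
    have h := decay_from_pointwise y μ n (fun k => (fun _ : TorusSite 4 L => (1 : ℂ)) k * (1 - 0 * Complex.exp (-(Complex.I * ((2 * Real.pi * (ZMod.val (k μ) : ℝ) / L : ℝ) : ℂ)))) * Complex.exp (-(σ : ℂ) * ((((m + ∑ ν : Fin 4, (1 - Real.cos (2 * Real.pi * (ZMod.val (k ν) : ℝ) / L))) ^ 2 + ∑ ν : Fin 4, Real.sin (2 * Real.pi * (ZMod.val (k ν) : ℝ) / L) ^ 2) : ℝ) : ℂ)))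
      hσ (A := ((n.factorial : ℝ) * Real.exp 2 * (10 * Real.pi) ^ n * Real.exp (10 * Real.pi ^ 2 * (n : ℝ) ^ 2)) * Real.exp (-(σ * m ^ 2))) (R := 1) (by positivity) zero_le_one
      (fun k => (Real.exp (-(σ * (∑ ν ∈ Finset.univ.erase μ, (1 - Real.cos (2 * Real.pi * (ZMod.val (k ν) : ℝ) / L))))) * Real.exp (-(σ / 8 * (1 - Real.cos (2 * Real.pi * (ZMod.val (k μ) : ℝ) / L))))))
      (fun k => by
        refine (hΔ k).trans (le_of_eq ?_)
        simp only [norm_one, norm_zero, sub_zero, mul_zero, zero_mul, add_zero, mul_one]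
        ring)
      (by rw [one_mul]; exact sum_weight_le hσ hσL μ)
    refine h.trans ?_
    have hnn : 0 ≤ ((n.factorial : ℝ) * Real.exp 2 * (10 * Real.pi) ^ n * Real.exp (10 * Real.pi ^ 2 * (n : ℝ) ^ 2)) * 12 ^ 4 * Real.sqrt (1 + σ) ^ n * ((1 + σ) ^ 2)⁻¹ * Real.exp (-(σ * m ^ 2)) := by
      positivity
    nlinarith [hnn]
  · -- differences
    have hdiff : (∑ k : TorusSite 4 L, ((L : ℂ) ^ 2)⁻¹ * ((L : ℂ) ^ 2)⁻¹ * (Complex.exp (-(σ : ℂ) * ((((m + ∑ ν : Fin 4, (1 - Real.cos (2 * Real.pi * (ZMod.val (k ν) : ℝ) / L))) ^ 2 + ∑ ν : Fin 4, Real.sin (2 * Real.pi * (ZMod.val (k ν) : ℝ) / L) ^ 2) : ℝ) : ℂ)) * torusChar k y)) - (∑ k : TorusSite 4 L, ((L : ℂ) ^ 2)⁻¹ * ((L : ℂ) ^ 2)⁻¹ * (Complex.exp (-(σ : ℂ) * ((((m + ∑ ν : Fin 4, (1 - Real.cos (2 * Real.pi * (ZMod.val (k ν) : ℝ) / L)))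 ^ 2 + ∑ ν : Fin 4, Real.sin (2 * Real.pi * (ZMod.val (k ν) : ℝ) / L) ^ 2) : ℝ) : ℂ)) * torusChar k (y - Pi.single ν 1))) =
        ∑ k : TorusSite 4 L, ((L : ℂ) ^ 2)⁻¹ * ((L : ℂ) ^ 2)⁻¹ *
          (((1 - conj (torusChar k (Pi.single ν 1))) * Complex.exp (-(σ : ℂ) * ((((m + ∑ ν : Fin 4, (1 - Real.cos (2 * Real.pi * (ZMod.val (k ν) : ℝ) / L))) ^ 2 + ∑ ν : Fin 4, Real.sin (2 * Real.pi * (ZMod.val (k ν) : ℝ) / L) ^ 2) : ℝ) : ℂ))) * torusChar k y) := by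
      rw [← Finset.sum_sub_distrib]
      refine Finset.sum_congr rfl fun k _ => ?_
      rw [torusChar_sub_right]
      ring
    rw [hdiff]
    by_cases hνμ : ν = μ
    · subst hνμ
      -- `p = 1`, `a = 1`
      have hΔ := hP 1 (fun _ => 1) (fun _ => rfl)
      have hsum : ∑ k : TorusSite 4 L, ((L : ℂ) ^ 2)⁻¹ * ((L : ℂ) ^ 2)⁻¹ *
          (((1 - conj (torusChar k (Pi.single ν 1))) * Complex.exp (-(σ : ℂ) * ((((m + ∑ ν : Fin 4, (1 - Real.cos (2 * Real.pi * (ZMod.val (k ν) : ℝ) / L))) ^ 2 + ∑ ν : Fin 4, Real.sin (2 * Real.pi * (ZMod.val (k ν) : ℝ) / L) ^ 2) : ℝ) : ℂ))) * torusChar k y) =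
          ∑ k : TorusSite 4 L, ((L : ℂ) ^ 2)⁻¹ * ((L : ℂ) ^ 2)⁻¹ *
          (((fun _ : TorusSite 4 L => (1 : ℂ)) k * (1 - 1 * Complex.exp (-(Complex.I * ((2 * Real.pi * (ZMod.val (k ν) : ℝ) / L : ℝ) : ℂ)))) * Complex.exp (-(σ : ℂ) * ((((m + ∑ ν : Fin 4, (1 - Real.cos (2 * Real.pi * (ZMod.val (k ν) : ℝ) / L))) ^ 2 + ∑ ν : Fin 4, Real.sin (2 * Real.pi * (ZMod.val (k ν) : ℝ) / L) ^ 2) : ℝ) : ℂ))) * torusChar k y) := by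
        refine Finset.sum_congr rfl fun k _ => ?_
        rw [conj_torusChar_single]
        ring
      rw [hsum]
      have h := decay_from_pointwise y ν n (fun k => (fun _ : TorusSite 4 L => (1 : ℂ)) k * (1 - 1 * Complex.exp (-(Complex.I * ((2 * Real.pi * (ZMod.val (k ν) : ℝ) / L : ℝ) : ℂ)))) * Complex.exp (-(σ : ℂ) * ((((m + ∑ ν : Fin 4, (1 - Real.cos (2 * Real.pi * (ZMod.val (k ν) : ℝ) / L))) ^ 2 + ∑ ν : Fin 4, Real.sin (2 * Real.pi * (ZMod.val (k ν) : ℝ) / L) ^ 2) : ℝ) : ℂ)))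
        hσ (A := ((n.factorial : ℝ) * Real.exp 2 * (10 * Real.pi) ^ n * Real.exp (10 * Real.pi ^ 2 * (n : ℝ) ^ 2)) * (6 * (Real.sqrt (1 + σ))⁻¹) * Real.exp (-(σ * m ^ 2))) (R := 1)
        (by positivity) zero_le_one
        (fun k => (Real.exp (-(σ * (∑ ν ∈ Finset.univ.erase ν, (1 - Real.cos (2 * Real.pi * (ZMod.val (k ν) : ℝ) / L))))) * Real.exp (-(σ / 8 * (1 - Real.cos (2 * Real.pi * (ZMod.val (k ν) : ℝ) / L))))))
        (fun k => by
          refine (hΔ k).trans (le_of_eq ?_)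
          simp only [sub_self, norm_one, norm_zero, zero_add, mul_one]
          ring)
        (by rw [one_mul]; exact sum_weight_le hσ hσL ν)
      refine h.trans (le_of_eq ?_)
      ring
    · -- `p = 1 − conj χ_k(e_ν)`, `a = 0`
      have hp : ∀ k : TorusSite 4 L, (1 - conj (torusChar (k + Pi.single μ 1) (Pi.single ν 1))) =
          1 - conj (torusChar k (Pi.single ν 1)) := by
        intro k
        rw [conj_torusChar_single, conj_torusChar_single, Pi.add_apply,
          Pi.single_eq_of_ne hνμ, add_zero]
      have hΔ := hP 0 (fun k => 1 - conj (torusChar k (Pi.single ν 1))) hp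
      have hsum : ∑ k : TorusSite 4 L, ((L : ℂ) ^ 2)⁻¹ * ((L : ℂ) ^ 2)⁻¹ *
          (((1 - conj (torusChar k (Pi.single ν 1))) * Complex.exp (-(σ : ℂ) * ((((m + ∑ ν : Fin 4, (1 - Real.cos (2 * Real.pi * (ZMod.val (k ν) : ℝ) / L))) ^ 2 + ∑ ν : Fin 4, Real.sin (2 * Real.pi * (ZMod.val (k ν) : ℝ) / L) ^ 2) : ℝ) : ℂ))) * torusChar k y) =
          ∑ k : TorusSite 4 L, ((L : ℂ) ^ 2)⁻¹ * ((L : ℂ) ^ 2)⁻¹ *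
          (((fun k : TorusSite 4 L => 1 - conj (torusChar k (Pi.single ν 1))) k * (1 - 0 * Complex.exp (-(Complex.I * ((2 * Real.pi * (ZMod.val (k μ) : ℝ) / L : ℝ) : ℂ)))) * Complex.exp (-(σ : ℂ) * ((((m + ∑ ν : Fin 4, (1 - Real.cos (2 * Real.pi * (ZMod.val (k ν) : ℝ) / L))) ^ 2 + ∑ ν : Fin 4, Real.sin (2 * Real.pi * (ZMod.val (k ν) : ℝ) / L) ^ 2) : ℝ) : ℂ))) * torusChar k y) := by
        refine Finset.sum_congr rfl fun k _ => ?_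
        simp
      rw [hsum]
      have h := decay_from_pointwise y μ n
        (fun k => (fun k : TorusSite 4 L => 1 - conj (torusChar k (Pi.single ν 1))) k * (1 - 0 * Complex.exp (-(Complex.I * ((2 * Real.pi * (ZMod.val (k μ) : ℝ) / L : ℝ) : ℂ)))) * Complex.exp (-(σ : ℂ) * ((((m + ∑ ν : Fin 4, (1 - Real.cos (2 * Real.pi * (ZMod.val (k ν) : ℝ) / L))) ^ 2 + ∑ ν : Fin 4, Real.sin (2 * Real.pi * (ZMod.val (k ν) : ℝ) / L) ^ 2) : ℝ) : ℂ)))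
        hσ (A := ((n.factorial : ℝ) * Real.exp 2 * (10 * Real.pi) ^ n * Real.exp (10 * Real.pi ^ 2 * (n : ℝ) ^ 2)) * Real.exp (-(σ * m ^ 2))) (R := 4 * (Real.sqrt (1 + σ))⁻¹)
        (by positivity) (by positivity)
        (fun k => ‖1 - conj (torusChar k (Pi.single ν 1))‖ * (Real.exp (-(σ * (∑ ν ∈ Finset.univ.erase μ, (1 - Real.cos (2 * Real.pi * (ZMod.val (k ν) : ℝ) / L))))) * Real.exp (-(σ / 8 * (1 - Real.cos (2 * Real.pi * (ZMod.val (k μ) : ℝ) / L))))))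
        (fun k => by
          refine (hΔ k).trans (le_of_eq ?_)
          simp only [norm_one, norm_zero, sub_zero, mul_zero, zero_mul, add_zero, mul_one]
          ring)
        (sum_norm_mul_weight_le hσ hσL hνμ)
      refine h.trans ?_
      have hnn : 0 ≤ ((n.factorial : ℝ) * Real.exp 2 * (10 * Real.pi) ^ n * Real.exp (10 * Real.pi ^ 2 * (n : ℝ) ^ 2)) * 12 ^ 4 * Real.sqrt (1 + σ) ^ n * (Real.sqrt (1 + σ))⁻¹ * ((1 + σ) ^ 2)⁻¹ *
          Real.exp (-(σ * m ^ 2)) := by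
        positivity
      nlinarith [hnn]

/-! ### Interpolation between the `n = 0` and `n = 6` moment bounds -/

/-- Entries: `X ≤ C₀ t⁻² E` and `d⁶ X ≤ C₆ s⁶ t⁻² E` (`s² = t ≥ 1`, `C₀ ≥ 0`) give
`X ≤ 8 max(C₀,C₆) E t / (t + d²)³`. -/
theorem interp_entry {X C₀ C₆ s t d E : ℝ} (hX : 0 ≤ X) (ht : 1 ≤ t) (hst : s ^ 2 = t)
    (hE : 0 < E) (hC₀ : 0 ≤ C₀)
    (h0 : X ≤ C₀ * (t ^ 2)⁻¹ * E) (h6 : d ^ 6 * X ≤ C₆ * s ^ 6 * (t ^ 2)⁻¹ * E) :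
    X ≤ 8 * max C₀ C₆ * E * t / (t + d ^ 2) ^ 3 := by
  subst hst
  have hs2 : (0 : ℝ) < s ^ 2 := by linarith
  have hM0 : C₀ ≤ max C₀ C₆ := le_max_left _ _
  have hM6 : C₆ ≤ max C₀ C₆ := le_max_right _ _
  have hden : 0 < (s ^ 2 + d ^ 2) ^ 3 := by positivity
  rw [le_div_iff₀ hden]
  rcases le_or_gt (d ^ 2) (s ^ 2) with hc | hc
  · have h8 : (s ^ 2 + d ^ 2) ^ 3 ≤ 8 * (s ^ 2) ^ 3 := by
      calc (s ^ 2 + d ^ 2) ^ 3 ≤ (2 * s ^ 2) ^ 3 := pow_le_pow_left₀ (by positivity) (by linarith) 3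
        _ = 8 * (s ^ 2) ^ 3 := by ring
    calc X * (s ^ 2 + d ^ 2) ^ 3 ≤ (C₀ * ((s ^ 2) ^ 2)⁻¹ * E) * (8 * (s ^ 2) ^ 3) :=
          mul_le_mul h0 h8 hden.le (by positivity)
      _ = 8 * C₀ * E * s ^ 2 := by field_simp
      _ ≤ 8 * max C₀ C₆ * E * s ^ 2 := by gcongr
  · have h8 : (s ^ 2 + d ^ 2) ^ 3 ≤ 8 * d ^ 6 := by
      calc (s ^ 2 + d ^ 2) ^ 3 ≤ (2 * d ^ 2) ^ 3 := pow_le_pow_left₀ (by positivity) (by linarith) 3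
        _ = 8 * d ^ 6 := by ring
    calc X * (s ^ 2 + d ^ 2) ^ 3 ≤ X * (8 * d ^ 6) := mul_le_mul_of_nonneg_left h8 hX
      _ = 8 * (d ^ 6 * X) := by ring
      _ ≤ 8 * (C₆ * s ^ 6 * ((s ^ 2) ^ 2)⁻¹ * E) := by gcongr
      _ = 8 * C₆ * E * s ^ 2 := by field_simp
      _ ≤ 8 * max C₀ C₆ * E * s ^ 2 := by gcongr

/-- Differences: `Y ≤ C₀ s⁻¹ t⁻² E` and `d⁶ Y ≤ C₆ s⁶ s⁻¹ t⁻² E` (`s² = t ≥ 1`) give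
`Y ≤ 8 max(C₀,C₆) E s / (t + d²)³`. -/
theorem interp_diff {Y C₀ C₆ s t d E : ℝ} (hY : 0 ≤ Y) (ht : 1 ≤ t) (hst : s ^ 2 = t) (hs : 0 < s)
    (hE : 0 < E) (hC₀ : 0 ≤ C₀)
    (h0 : Y ≤ C₀ * s⁻¹ * (t ^ 2)⁻¹ * E) (h6 : d ^ 6 * Y ≤ C₆ * s ^ 6 * s⁻¹ * (t ^ 2)⁻¹ * E) :
    Y ≤ 8 * max C₀ C₆ * E * s / (t + d ^ 2) ^ 3 := by
  subst hst
  have hs1 : (1 : ℝ) ≤ s ^ 2 := ht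
  have hM0 : C₀ ≤ max C₀ C₆ := le_max_left _ _
  have hM6 : C₆ ≤ max C₀ C₆ := le_max_right _ _
  have hden : 0 < (s ^ 2 + d ^ 2) ^ 3 := by positivity
  rw [le_div_iff₀ hden]
  rcases le_or_gt (d ^ 2) (s ^ 2) with hc | hc
  · have h8 : (s ^ 2 + d ^ 2) ^ 3 ≤ 8 * (s ^ 2) ^ 3 := by
      calc (s ^ 2 + d ^ 2) ^ 3 ≤ (2 * s ^ 2) ^ 3 := pow_le_pow_left₀ (by positivity) (by linarith) 3
        _ = 8 * (s ^ 2) ^ 3 := by ring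
    calc Y * (s ^ 2 + d ^ 2) ^ 3 ≤ (C₀ * s⁻¹ * ((s ^ 2) ^ 2)⁻¹ * E) * (8 * (s ^ 2) ^ 3) :=
          mul_le_mul h0 h8 hden.le (by positivity)
      _ = 8 * C₀ * E * s := by field_simp
      _ ≤ 8 * max C₀ C₆ * E * s := by gcongr
  · have h8 : (s ^ 2 + d ^ 2) ^ 3 ≤ 8 * d ^ 6 := by
      calc (s ^ 2 + d ^ 2) ^ 3 ≤ (2 * d ^ 2) ^ 3 := pow_le_pow_left₀ (by positivity) (by linarith) 3
        _ = 8 * d ^ 6 := by ring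
    calc Y * (s ^ 2 + d ^ 2) ^ 3 ≤ Y * (8 * d ^ 6) := mul_le_mul_of_nonneg_left h8 hY
      _ = 8 * (d ^ 6 * Y) := by ring
      _ ≤ 8 * (C₆ * s ^ 6 * s⁻¹ * ((s ^ 2) ^ 2)⁻¹ * E) := by gcongr
      _ = 8 * C₆ * E * s := by field_simp
      _ ≤ 8 * max C₀ C₆ * E * s := by gcongr

/-! ### The stub -/

/-- **Free massive Wilson heat kernel: parabolic polynomial decay** (registered stub
`stub_freeKernelDecay` of line `point-centred-axial-parabolic`).  If the heat kernel
`e^{−σ D₁ᴴD₁}` of the FREE massive Wilson operator on `(ℤ/L)⁴` is the torus Fourier sum of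
`e^{−σ h_m(k)}`, `h_m(k) = (m + Σ_μ (1 − cos θ_μ))² + Σ_μ sin² θ_μ`, then, uniformly in `L ≥ 1`,
`m ∈ [−1/2, 1]` and `0 ≤ σ ≤ L²`, its entries are bounded by `C e^{−σm²} (1+σ)/(1+σ+d²)³` and its
nearest-neighbour column differences by `C e^{−σm²} √(1+σ)/(1+σ+d²)³`, `d = torusDist x z`
(six momentum differences of the symbol, Cauchy estimates in one complexified angle, Gaussian
Riemann sums; `c = 1`). -/
theorem stub_freeKernelDecay :
    (∀ (L : ℕ) [NeZero L] (m σ : ℝ) (x z : TorusSite 4 L) (a b : Fin 3) (α β : Fin 4),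
      (NormedSpace.exp (-(σ : ℂ) •
          ((wilsonDirac (fundamentalRep (Fin 3)) (freeCfg L) m 1)ᴴ *
            wilsonDirac (fundamentalRep (Fin 3)) (freeCfg L) m 1))) (x, a, α) (z, b, β) =
        if (a, α) = (b, β) then
          ∑ k : TorusSite 4 L, ((L : ℂ) ^ 2)⁻¹ * ((L : ℂ) ^ 2)⁻¹ *
            (Complex.exp (-(σ : ℂ) *
              (((m + ∑ μ : Fin 4, (1 - Real.cos (2 * Real.pi * (ZMod.val (k μ) : ℝ) / L))) ^ 2 +
                  ∑ μ : Fin 4, Real.sin (2 * Real.pi * (ZMod.val (k μ) : ℝ) / L) ^ 2 : ℝ) : ℂ)) *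
              (torusChar k x * conj (torusChar k z)))
        else 0) →
    (∃ C c : ℝ, 0 < c ∧ ∀ (L : ℕ) [NeZero L] (m : ℝ), m ∈ Set.Icc (-(1 / 2 : ℝ)) 1 →
      ∀ σ : ℝ, 0 ≤ σ → σ ≤ (L : ℝ) ^ 2 →
      ∀ (x z : TorusSite 4 L) (a b : Fin 3) (α β : Fin 4),
        ‖(NormedSpace.exp (-(σ : ℂ) •
            ((wilsonDirac (fundamentalRep (Fin 3)) (freeCfg L) m 1)ᴴ *
              wilsonDirac (fundamentalRep (Fin 3)) (freeCfg L) m 1))) (x, a, α) (z, b, β)‖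
          ≤ C * Real.exp (-(c * σ * m ^ 2)) * (1 + σ) / (1 + σ + (torusDist x z : ℝ) ^ 2) ^ 3 ∧
        ∀ μ : Fin 4,
          ‖(NormedSpace.exp (-(σ : ℂ) •
              ((wilsonDirac (fundamentalRep (Fin 3)) (freeCfg L) m 1)ᴴ *
                wilsonDirac (fundamentalRep (Fin 3)) (freeCfg L) m 1))) (x, a, α) (z, b, β) -
            (NormedSpace.exp (-(σ : ℂ) •
              ((wilsonDirac (fundamentalRep (Fin 3)) (freeCfg L) m 1)ᴴ *
                wilsonDirac (fundamentalRep (Fin 3)) (freeCfg L) m 1))) (x, a, α) (Site.shift z μ, b, β)‖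
          ≤ C * Real.exp (-(c * σ * m ^ 2)) * Real.sqrt (1 + σ) / (1 + σ + (torusDist x z : ℝ) ^ 2) ^ 3) := by
  intro hF
  obtain ⟨C₀, hC₀, h0⟩ := fourierSum_decay 0
  obtain ⟨C₆, -, h6⟩ := fourierSum_decay 6
  refine ⟨8 * max C₀ C₆, 1, one_pos, ?_⟩
  intro L _ m hm σ hσ hσL x z a b α β
  have hs : 0 < Real.sqrt (1 + σ) := Real.sqrt_pos.2 (by linarith)
  have hsq : Real.sqrt (1 + σ) ^ 2 = 1 + σ := Real.sq_sqrt (by linarith)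
  have hE : 0 < Real.exp (-(σ * m ^ 2)) := Real.exp_pos _
  set y : TorusSite 4 L := x - z with hy
  have hdist : (torusDist x z : ℝ) = ((torusNorm y : ℕ) : ℝ) := by rw [hy]; rfl
  obtain ⟨μ, hμ⟩ := exists_torusNorm_eq y
  have h0y := h0 L m hm σ hσ hσL y μ
  have h6y := h6 L m hm σ hσ hσL y μ
  rw [← hμ] at h6y
  simp only [pow_zero, one_mul, mul_one] at h0y
  simp only [one_mul]
  rw [hdist]
  by_cases hab : (a, α) = (b, β)
  · -- the kernel is the Fourier sum `K_σ(x − z')`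
    have hK : ∀ z' : TorusSite 4 L,
        (NormedSpace.exp (-(σ : ℂ) •
            ((wilsonDirac (fundamentalRep (Fin 3)) (freeCfg L) m 1)ᴴ *
              wilsonDirac (fundamentalRep (Fin 3)) (freeCfg L) m 1))) (x, a, α) (z', b, β) =
          (∑ k : TorusSite 4 L, ((L : ℂ) ^ 2)⁻¹ * ((L : ℂ) ^ 2)⁻¹ * (Complex.exp (-(σ : ℂ) * ((((m + ∑ ν : Fin 4, (1 - Real.cos (2 * Real.pi * (ZMod.val (k ν) : ℝ) / L))) ^ 2 + ∑ ν : Fin 4, Real.sin (2 * Real.pi * (ZMod.val (k ν) : ℝ) / L) ^ 2) : ℝ) : ℂ)) * torusChar k (x - z'))) := by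
      intro z'
      rw [hF, if_pos hab]
      refine Finset.sum_congr rfl fun k _ => ?_
      rw [← torusChar_sub_right]
    refine ⟨?_, fun ν => ?_⟩
    · rw [hK z, ← hy]
      exact interp_entry (norm_nonneg _) (by linarith) hsq hE hC₀ h0y.1 h6y.1
    · rw [hK z, hK (Site.shift z ν), ← hy]
      have hshift : x - Site.shift z ν = y - Pi.single ν 1 := by
        rw [hy, Site.shift, sub_add_eq_sub_sub]
      rw [hshift]
      exact interp_diff (norm_nonneg _) (by linarith) hsq hs hE hC₀ (h0y.2 ν) (h6y.2 ν)
  · -- off the colour–spin diagonal everything vanishes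
    have hK : ∀ z' : TorusSite 4 L,
        (NormedSpace.exp (-(σ : ℂ) •
            ((wilsonDirac (fundamentalRep (Fin 3)) (freeCfg L) m 1)ᴴ *
              wilsonDirac (fundamentalRep (Fin 3)) (freeCfg L) m 1))) (x, a, α) (z', b, β) = 0 := by
      intro z'
      rw [hF, if_neg hab]
    refine ⟨?_, fun ν => ?_⟩
    · rw [hK z, norm_zero]
      positivity
    · rw [hK z, hK (Site.shift z ν), sub_zero, norm_zero]
      positivity

end Summit.QuantumFields.QCD.Cruxes.SmallFieldUltracontractivity.PointCentredAxialParabolic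

end
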